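import Summits.QuantumFields.YangMills.Theorems.PoincareLipschitzAvgStabilityOfOrbitMinimising
import Literature.MathematicalPhysics.QuantumFieldTheory.Balaban1983to89.MatrixNorms
import Literature.LinearAlgebra.Matrix.UnitaryGroupExpSurjective
import HarnessLib

/-!
# Crux stmt-QuantumFields-19936 `UnitScaleTilt.HistoryTailL`, K2 at depth (route crux `PoincareLipschitz.BlockLipschitzL`, stmt-QuantumFields-23533):
# THE U-COULOMB LETTER OF A BOX-ℓ²-ORBIT MINIMISER (first-order optimality of the pairs singled out by ✓`avgStabilityModGauge_of_orbitMinimising`)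

✓`PoincareLipschitzAvgStabilityOrbitMin.avgStabilityModGauge_of_orbitMinimising` (this seat, p681042) reduced the displayed row «average stability
modulo gauge» of the K2-TOP door (✓p679967) to pairs `(U, U')` of level-zero `SU(2)` fields in which `U'` is a box-`ℓ²`-closest point of its own
level-zero gauge orbit to `U`: `∀ k, Σ_{b∈box} dist1(U_b U'_b⁻¹)² ≤ Σ_{b∈box} dist1(U_b ((U'^k)_b)⁻¹)²`.  This file records what that minimality
gives a supplier AT EACH SITE, in the tree's letters and with no definition:

* §1 `reTr_oneSite_le_of_orbitMin` — the ONE-SITE COMPETITOR `k = δ_x^g` (`g` at `x`, `1` elsewhere): for every site `x` and every `g ∈ SU(2)`,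
  `Σ_{b∈box, b₋=x} Re tr(g·U'_bU_b⁻¹) + Σ_{b∈box, b₊=x} Re tr(g·U'_b⁻¹U_b) ≤ (the same at g = 1)` (normalised traces `reTr`): on `SU(2)`
  `dist1² = 2(1 − reTr)` (✓`MatrixNorms.opDist1_sq_eq_of_mem_specialUnitaryGroup_two`), `reTr g⁻¹ = reTr g`, `reTr (hgh⁻¹) = reTr g`, and a bond
  never has `b₊ = b₋` (`sitesPerDir ≥ 2`).  In words: the real-linear site functional `g ↦ Re tr(g·M_x)`,
  `M_x := Σ_{b∈box,b₋=x} U'_bU_b⁻¹ + Σ_{b∈box,b₊=x} U'_b⁻¹U_b`, is MAXIMAL on `SU(2)` at `g = 1`.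
* §2 `re_trace_mul_eq_zero_of_forall_le` — the generic `SU(2)` letter: if `g ↦ Re tr(g·M)` (`M ∈ M₂(ℂ)` arbitrary) is maximal on `SU(2)` at `1`, then
  `Re tr(X·M) = 0` for every `X ∈ 𝔰𝔲(2)` (one-parameter subgroup `t ↦ exp(tX)` ✓`exp_mem_specialUnitaryGroup_of_mem_skewAdjoint`, derivative
  `hasDerivAt_exp_smul_const'`, interior maximum `IsLocalMax.hasDerivAt_eq_zero`).
* §3 ★★ `re_trace_su_mul_siteSum_eq_zero_of_orbitMin` — THE DISCRETE `U`-COVARIANT COULOMB CONDITION of an orbit-minimising pair: for every site `x`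
  and every `X ∈ 𝔰𝔲(2)`, `Re tr(X·M_x) = 0`, i.e. the `𝔰𝔲(2)`-part of `M_x` — the covariant lattice divergence at `x` of the perturbation
  `W_b = U'_bU_b⁻¹` (outgoing bonds enter as `W_b`, incoming ones transported back as `U_b⁻¹W_b⁻¹U_b`) — VANISHES.  Divergence-free and (by the local
  goodness of both fields) curl-small is the elliptic regime in which the perturbation is automatically sup-small, i.e. the perturbative regime of
  [Balaban1985Averaging] Props. 3–5, (156)–(163), from which a supplier of the restricted row starts.

WHAT THIS IS NOT: nothing here proves the restricted row, `stub_iteratedLipschitz`, the crux `BlockLipschitzL`, the crux `HistoryTailL`, rung R3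
(YM₃ on T³ — not d = 4, not infinite volume, not a mass gap, not the Clay problem) or a summit statement.
Width seat ym-ust-19936-w5 g10 (cell ym3-torus), `--supports stmt-QuantumFields-19936`.
-/

noncomputable section

open scoped BigOperators Matrix.Norms.L2Operator Matrix Topology

namespace Summit.QuantumFields.YangMills.Theorems.PoincareLipschitzOrbitMinCoulomb

open Literature.MathematicalPhysics.QuantumFieldTheory.Balaban1983to89
open NormedSpace
open Literature.LinearAlgebra.Matrix (exp_mem_specialUnitaryGroup_of_mem_skewAdjoint)

/-! ## §1 The one-site competitor: the site functional `g ↦ Re tr(g·M_x)` is maximal at `g = 1` -/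

section OneSite

variable {P : Params}

/-- **THE ONE-SITE COMPETITOR OF A BOX-ℓ²-ORBIT MINIMISER.**  If `U'` is a box-`ℓ²`-closest point of its level-zero gauge orbit to `U`
(`∀ k, Σ_box dist1(U_b U'_b⁻¹)² ≤ Σ_box dist1(U_b((U'^k)_b)⁻¹)²`), then for every site `x` and every `g ∈ SU(2)`
`Σ_{b∈box, b₋=x} reTr(g·U'_bU_b⁻¹) + Σ_{b∈box, b₊=x} reTr(g·U'_b⁻¹U_b) ≤ Σ_{b∈box, b₋=x} reTr(U'_bU_b⁻¹) + Σ_{b∈box, b₊=x} reTr(U'_b⁻¹U_b)`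
(test the minimality at the gauge transformation equal to `g` at `x` and `1` elsewhere; `dist1² = 2(1 − reTr)` on `SU(2)`). [cite: Balaban1987RG1, (0.14) p.254] -/
theorem reTr_oneSite_le_of_orbitMin (box : PBond P 0 → Prop) [DecidablePred box]
    (U U' : GaugeField P 0 (Matrix.specialUnitaryGroup (Fin 2) ℂ))
    (hmin : ∀ k : GaugeTransf P 0 (Matrix.specialUnitaryGroup (Fin 2) ℂ),
      (∑ b : PBond P 0, if box b then dist1 (U b * (U' b)⁻¹) ^ 2 else 0) ≤
        ∑ b : PBond P 0, if box b then dist1 (U b * (GaugeField.gaugeAct k U' b)⁻¹) ^ 2 else 0)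
    (x : Site P 0) (g : Matrix.specialUnitaryGroup (Fin 2) ℂ) :
    (∑ b : PBond P 0, if box b ∧ b.src = x then reTr (g * (U' b * (U b)⁻¹)) else 0) +
        (∑ b : PBond P 0, if box b ∧ b.tgt = x then reTr (g * ((U' b)⁻¹ * U b)) else 0) ≤
      (∑ b : PBond P 0, if box b ∧ b.src = x then reTr (U' b * (U b)⁻¹) else 0) +
        (∑ b : PBond P 0, if box b ∧ b.tgt = x then reTr ((U' b)⁻¹ * U b) else 0) := by
  -- `SU(2)`: `|g − 1|² = 2(1 − Re tr g)`
  have hsq : ∀ h : Matrix.specialUnitaryGroup (Fin 2) ℂ, dist1 h ^ 2 = 2 * (1 - reTr h) := fun h =>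
    MatrixNorms.opDist1_sq_eq_of_mem_specialUnitaryGroup_two h.2
  -- no bond is a loop: `b₊ ≠ b₋` (`sitesPerDir 0 = 2·L^{m+K} ≥ 2`)
  have hN : 1 < P.sitesPerDir 0 := by
    have h1 : 1 ≤ P.L ^ (P.m + P.K - 0) := Nat.one_le_pow _ _ P.L_pos
    show 1 < 2 * P.L ^ (P.m + P.K - 0)
    omega
  haveI : Fact (1 < P.sitesPerDir 0) := ⟨hN⟩
  have hne : ∀ b : PBond P 0, ¬ (b.src = x ∧ b.tgt = x) := by
    rintro b ⟨hs, ht⟩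
    have h1 : b.src.shift b.dir b.dir = b.src b.dir := by
      have : b.src.shift b.dir = b.src := ht.trans hs.symm
      rw [this]
    simp only [Site.shift, Function.update_self, add_eq_left] at h1
    exact one_ne_zero h1
  -- the one-site competitor
  set δ : GaugeTransf P 0 (Matrix.specialUnitaryGroup (Fin 2) ℂ) := fun y => if y = x then g else 1 with hδ
  have key := hmin δ
  -- termwise evaluation of the competitor's box distance
  have hterm : ∀ b : PBond P 0,
      (if box b then dist1 (U b * (GaugeField.gaugeAct δ U' b)⁻¹) ^ 2 else 0) =
        (if box b then dist1 (U b * (U' b)⁻¹) ^ 2 else 0) +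
          2 * ((if box b ∧ b.src = x then reTr (U' b * (U b)⁻¹) else 0) - (if box b ∧ b.src = x then reTr (g * (U' b * (U b)⁻¹)) else 0)) +
          2 * ((if box b ∧ b.tgt = x then reTr ((U' b)⁻¹ * U b) else 0) - (if box b ∧ b.tgt = x then reTr (g * ((U' b)⁻¹ * U b)) else 0)) := by
    intro b
    by_cases hb : box b
    · by_cases hs : b.src = x
      · have ht : ¬ b.tgt = x := fun ht => hne b ⟨hs, ht⟩
        have hgauge : GaugeField.gaugeAct δ U' b = g * U' b := by
          simp [GaugeField.gaugeAct, hδ, hs, ht]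
        simp only [if_pos hb, if_pos (And.intro hb hs), if_neg (fun h : box b ∧ b.tgt = x => ht h.2), hgauge, sub_self,
          mul_zero, add_zero]
        rw [hsq, hsq]
        have e1 : reTr (U b * (U' b)⁻¹) = reTr (U' b * (U b)⁻¹) := by
          rw [← GaugeGroup.reTr_inv]; congr 1; group
        have e2 : reTr (U b * (g * U' b)⁻¹) = reTr (g * (U' b * (U b)⁻¹)) := by
          rw [← GaugeGroup.reTr_inv]; congr 1; group
        rw [e1, e2]; ring
      · by_cases ht : b.tgt = x
        · have hgauge : GaugeField.gaugeAct δ U' b = U' b * g⁻¹ := by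
            simp [GaugeField.gaugeAct, hδ, hs, ht]
          simp only [if_pos hb, if_neg (fun h : box b ∧ b.src = x => hs h.2), if_pos (And.intro hb ht), hgauge, sub_self,
            mul_zero, add_zero]
          rw [hsq, hsq]
          have e1 : reTr (U b * (U' b)⁻¹) = reTr ((U' b)⁻¹ * U b) := by
            rw [← GaugeGroup.reTr_conj ((U' b)⁻¹ * U b) (U b)]; congr 1; group
          have e2 : reTr (U b * (U' b * g⁻¹)⁻¹) = reTr (g * ((U' b)⁻¹ * U b)) := by
            rw [← GaugeGroup.reTr_conj (g * ((U' b)⁻¹ * U b)) (U b)]; congr 1; group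
          rw [e1, e2]; ring
        · have hgauge : GaugeField.gaugeAct δ U' b = U' b := by
            simp [GaugeField.gaugeAct, hδ, hs, ht]
          simp only [if_neg (fun h : box b ∧ b.src = x => hs h.2), if_neg (fun h : box b ∧ b.tgt = x => ht h.2), hgauge, sub_self,
            mul_zero, add_zero]
    · simp only [if_neg hb, if_neg (fun h : box b ∧ b.src = x => hb h.1), if_neg (fun h : box b ∧ b.tgt = x => hb h.1), sub_self,
        mul_zero, add_zero]
  rw [Finset.sum_congr rfl fun b _ => hterm b, Finset.sum_add_distrib, Finset.sum_add_distrib, ← Finset.mul_sum, ← Finset.mul_sum,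
    Finset.sum_sub_distrib, Finset.sum_sub_distrib] at key
  linarith

end OneSite

/-! ## §2 The generic `SU(2)` letter: maximality at `1` of `g ↦ Re tr(g·M)` kills `Re tr(X·M)` on `𝔰𝔲(2)` -/

section Generic

/-- **FIRST VARIATION ALONG A ONE-PARAMETER SUBGROUP.**  If the real-linear functional `g ↦ Re tr(g·M)` (`M ∈ M₂(ℂ)` arbitrary) restricted to
`SU(2)` is maximal at `g = 1`, then `Re tr(X·M) = 0` for every skew-Hermitian trace-free `X` (the curve `t ↦ exp(tX)` stays in `SU(2)`, the
composite is differentiable at `0` with derivative `Re tr(X·M)`, and an interior maximum has zero derivative). [cite: BrockerTomDieck1985, I (2.22) Ex. 7] -/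
theorem re_trace_mul_eq_zero_of_forall_le (M X : Matrix (Fin 2) (Fin 2) ℂ)
    (hmax : ∀ g : Matrix.specialUnitaryGroup (Fin 2) ℂ, (((g : Matrix (Fin 2) (Fin 2) ℂ) * M).trace).re ≤ (M.trace).re)
    (hX : X ∈ skewAdjoint (Matrix (Fin 2) (Fin 2) ℂ)) (htr : X.trace = 0) :
    ((X * M).trace).re = 0 := by
  -- the one-parameter subgroup stays in `SU(2)`
  have hmem : ∀ t : ℝ, exp (t • X) ∈ Matrix.specialUnitaryGroup (Fin 2) ℂ := fun t =>
    exp_mem_specialUnitaryGroup_of_mem_skewAdjoint (skewAdjoint.smul_mem t hX) (by rw [Matrix.trace_smul, htr, smul_zero])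
  have hle : ∀ t : ℝ, ((exp (t • X) * M).trace).re ≤ (M.trace).re := fun t => hmax ⟨exp (t • X), hmem t⟩
  -- the real-linear observable `A ↦ Re tr(A·M)`
  let Φ : Matrix (Fin 2) (Fin 2) ℂ →L[ℝ] ℝ :=
    Complex.reCLM.comp (LinearMap.toContinuousLinearMap ((Matrix.traceLinearMap (Fin 2) ℝ ℂ).comp (LinearMap.mulRight ℝ M)))
  have hΦ : ∀ A : Matrix (Fin 2) (Fin 2) ℂ, Φ A = ((A * M).trace).re := fun A => rfl
  -- derivative of the composite at `0`
  have h1 : HasDerivAt (fun t : ℝ => exp (t • X)) X 0 := by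
    have h := hasDerivAt_exp_smul_const' X (0 : ℝ)
    simp only [zero_smul, exp_zero, mul_one] at h
    exact h
  have h2 : HasDerivAt (fun t : ℝ => Φ (exp (t • X))) (Φ X) 0 := Φ.hasFDerivAt.comp_hasDerivAt (0 : ℝ) h1
  have h3 : HasDerivAt (fun t : ℝ => ((exp (t • X) * M).trace).re) (((X * M).trace).re) 0 := by
    simpa only [hΦ] using h2
  -- interior maximum at `0`
  have hf0 : ((exp ((0 : ℝ) • X) * M).trace).re = (M.trace).re := by rw [zero_smul, exp_zero, one_mul]
  have hmax0 : IsLocalMax (fun t : ℝ => ((exp (t • X) * M).trace).re) 0 :=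
    Filter.Eventually.of_forall fun t => (hle t).trans_eq hf0.symm
  exact hmax0.hasDerivAt_eq_zero h3

end Generic

/-! ## §3 The discrete `U`-covariant Coulomb condition of an orbit-minimising pair -/

section Coulomb

variable {P : Params}

/-- `reTr` on `SU(2)` is half the real part of the trace of the underlying matrix. [cite: Balaban1985Averaging, (19) p.21] -/
theorem reTr_eq_half_re_trace (V : Matrix.specialUnitaryGroup (Fin 2) ℂ) :
    reTr V = (((V : Matrix (Fin 2) (Fin 2) ℂ)).trace).re / 2 := by
  show UnitaryModel.nReTr _ = _
  simp [UnitaryModel.nReTr]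

/-- ★★ **THE U-COULOMB CONDITION OF A BOX-ℓ²-ORBIT MINIMISER.**  If `U'` is a box-`ℓ²`-closest point of its level-zero gauge orbit to `U`, then at
every site `x` and for every `X ∈ 𝔰𝔲(2)` (skew-Hermitian, trace-free)
`Re tr( X · [ Σ_{b∈box, b₋=x} U'_bU_b⁻¹ + Σ_{b∈box, b₊=x} U'_b⁻¹U_b ] ) = 0`:
the `𝔰𝔲(2)`-part of the covariant lattice divergence at `x` of the perturbation `W_b = U'_bU_b⁻¹` vanishes (§1 + §2).
[cite: Balaban1985Averaging, (156)–(163) p.42 (the regime this opens); Balaban1987RG1, (0.14) p.254] -/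
theorem re_trace_su_mul_siteSum_eq_zero_of_orbitMin (box : PBond P 0 → Prop) [DecidablePred box]
    (U U' : GaugeField P 0 (Matrix.specialUnitaryGroup (Fin 2) ℂ))
    (hmin : ∀ k : GaugeTransf P 0 (Matrix.specialUnitaryGroup (Fin 2) ℂ),
      (∑ b : PBond P 0, if box b then dist1 (U b * (U' b)⁻¹) ^ 2 else 0) ≤
        ∑ b : PBond P 0, if box b then dist1 (U b * (GaugeField.gaugeAct k U' b)⁻¹) ^ 2 else 0)
    (x : Site P 0) {X : Matrix (Fin 2) (Fin 2) ℂ} (hX : X ∈ skewAdjoint (Matrix (Fin 2) (Fin 2) ℂ)) (htr : X.trace = 0) :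
    ((X * ((∑ b : PBond P 0, if box b ∧ b.src = x then (((U' b : Matrix.specialUnitaryGroup (Fin 2) ℂ) : Matrix (Fin 2) (Fin 2) ℂ) * (((U b)⁻¹ : Matrix.specialUnitaryGroup (Fin 2) ℂ) : Matrix (Fin 2) (Fin 2) ℂ)) else 0) +
        (∑ b : PBond P 0, if box b ∧ b.tgt = x then ((((U' b)⁻¹ : Matrix.specialUnitaryGroup (Fin 2) ℂ) : Matrix (Fin 2) (Fin 2) ℂ) * ((U b : Matrix.specialUnitaryGroup (Fin 2) ℂ) : Matrix (Fin 2) (Fin 2) ℂ)) else 0))).trace).re = 0 := by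
  set M : Matrix (Fin 2) (Fin 2) ℂ :=
    (∑ b : PBond P 0, if box b ∧ b.src = x then (((U' b : Matrix.specialUnitaryGroup (Fin 2) ℂ) : Matrix (Fin 2) (Fin 2) ℂ) * (((U b)⁻¹ : Matrix.specialUnitaryGroup (Fin 2) ℂ) : Matrix (Fin 2) (Fin 2) ℂ)) else 0) +
      (∑ b : PBond P 0, if box b ∧ b.tgt = x then ((((U' b)⁻¹ : Matrix.specialUnitaryGroup (Fin 2) ℂ) : Matrix (Fin 2) (Fin 2) ℂ) * ((U b : Matrix.specialUnitaryGroup (Fin 2) ℂ) : Matrix (Fin 2) (Fin 2) ℂ)) else 0) with hM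
  refine re_trace_mul_eq_zero_of_forall_le M X (fun g => ?_) hX htr
  -- `Re tr(A·M)` distributes over the two site sums
  have hdist : ∀ A : Matrix (Fin 2) (Fin 2) ℂ, ((A * M).trace).re =
      (∑ b : PBond P 0, if box b ∧ b.src = x then ((A * (((U' b : Matrix.specialUnitaryGroup (Fin 2) ℂ) : Matrix (Fin 2) (Fin 2) ℂ) * (((U b)⁻¹ : Matrix.specialUnitaryGroup (Fin 2) ℂ) : Matrix (Fin 2) (Fin 2) ℂ))).trace).re else 0) +
        (∑ b : PBond P 0, if box b ∧ b.tgt = x then ((A * ((((U' b)⁻¹ : Matrix.specialUnitaryGroup (Fin 2) ℂ) : Matrix (Fin 2) (Fin 2) ℂ) * ((U b : Matrix.specialUnitaryGroup (Fin 2) ℂ) : Matrix (Fin 2) (Fin 2) ℂ))).trace).re else 0) := by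
    intro A
    rw [hM, mul_add, Finset.mul_sum, Finset.mul_sum, Matrix.trace_add, Matrix.trace_sum, Matrix.trace_sum, Complex.add_re,
      Complex.re_sum, Complex.re_sum]
    congr 1
    · refine Finset.sum_congr rfl fun b _ => ?_
      split_ifs <;> simp
    · refine Finset.sum_congr rfl fun b _ => ?_
      split_ifs <;> simp
  -- the group letters of §1, read in matrices
  have hg := reTr_oneSite_le_of_orbitMin box U U' hmin x g
  simp only [reTr_eq_half_re_trace, Submonoid.coe_mul] at hg
  rw [hdist, show (M.trace).re = ((1 * M).trace).re by rw [one_mul], hdist 1]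
  simp only [one_mul]
  have h2 : ∀ (c : PBond P 0 → Prop) [DecidablePred c] (f : PBond P 0 → ℝ),
      (∑ b : PBond P 0, if c b then f b / 2 else 0) = (∑ b : PBond P 0, if c b then f b else 0) / 2 := by
    intro c _ f
    rw [Finset.sum_div]
    exact Finset.sum_congr rfl fun b _ => by split_ifs <;> simp
  rw [h2, h2, h2, h2] at hg
  linarith

end Coulomb

end Summit.QuantumFields.YangMills.Theorems.PoincareLipschitzOrbitMinCoulomb
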